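import Summits.ABC.IUTFork.Cor312SlotLicenceExactContentM
import Summits.ABC.IUTFork.LDHWitness
import Literature.IUT.LogVolume.TensorPacketLicenceCellInhabited
import Literature.IUT.LogVolume.GenuineLogThetaPointDegrees
import HarnessLib

/-!
# [IUTchIII] Cor. 3.12, Step (xi-f) at the M-LEVEL setting — readings (P) and (U) AGREE AT THE LICENCE LEVEL over SINGLETON fibres:
# `SlotLicence ↔ Licence` whenever every fibre `V̲_u` has at most one member (e.g. `F_mod = ℚ`: EVERY genuine datum over a point with `d_mod = 1`)

PROOF-ONLY file (D-0012; no definitions, no `Prop` facts, no instances) of the abc-iut cell (branch C certificate seat abc-iut-C-cert-2 gen 4;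
row «P:M-SLOT-LICENCE-EXACT», corollary). TAKES NO SIDE on [IUTchIII] Cor. 3.12 (kurims manuscript p. 173–174; Step (x) p. 181, Step (xi-f) p. 184)
or on the reading (U)/(P) of `−|log(Θ)|`.

The two exact deciders at abc-iut-s2-p8's summand-route M-level sharp setting `settingPrVolSharpM` — abc-iut-w5-d166's for the (U) licence
(`qRegion_subset_thetaHull_settingPrVolSharpM_iff_radii`: antecedent over ALL slots `a` of a summand `v⃗`) and this seat's for the (P) SLOT licence
(`qRegion_subset_thetaSlotHull_settingPrVolSharpM_iff_radii`, p470778: antecedent at the LAST slot only) — have the SAME right-hand side and differ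
only in which slots' Θ-idele norms `‖t_{Θ,j,v̲_a}‖` enter. Over a fibre `V̲_u` with at most one member every summand `v⃗ : S^±_{j+1} → V̲_u` is CONSTANT,
so the two antecedents coincide:

* §1 `qRegion_subset_thetaSlotHull_iff_thetaHull_settingPrVolSharpM_of_subsingleton` — per packet `(j, u)`: `qRegion ⊆ slot hull ↔ qRegion ⊆ full hull`
  (radii witnesses exist at every place: abc-iut-w4-d026 `exists_shellRadii_witnesses`, so the statement is witness-free);
  **`slotLicence_iff_licence_settingPrVolSharpM_of_subsingleton`** — `SlotLicence ↔ Thm311ToCor312.Licence` when EVERY fibre is a subsingleton;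
  `slotLicence_of_licence_settingPrVolSharpM_of_subsingleton` / `not_licence_of_not_slotLicence_…` — then the (U) licence, hence the q-pinned hull-level
  clause S_H (abc-iut-w5-d068 `licence_of_pilotKummerCompatHull`; the M books' `hSHw`/`hNumOffBad_M` antecedent), IMPLIES the slot licence, i.e.
  **`¬ SlotLicence → ¬ S_H`**: wherever the M-line γ binder `hNumPOffBad_M` (p469493) is consumed, the M-line (U) binder `hNumOffBad_M` (p451523 /
  p457739) is consumed too;
* §2 `fibre_subsingleton_of_finrank_eq_one` / `…_of_dmod_eq_one` — the fibres of the M-level index skeleton of a genuine Θ-volume datum `T` over a point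
  `P` with `d_mod(P) = 1` (every RATIONAL point: `dmod (ratPoint q) = 1`) are subsingletons (`V̲_u ≅ V(F_mod)_p`, abc-iut-w5-d033 `fibreEquivPlacesOverM`;
  `[F_mod : ℚ] = d_mod`, abc-iut-S-d2 `finrank_rat_fieldOfModuli_eq_dmod`; one place over `p` in degree one, abc-iut-c312-d1
  `ValLine.placesOver_subsingleton_of_finrank_eq_one`); hence **`GenuineMSlot.slotLicence_iff_licence_of_dmod_eq_one`** at the M books' setting of
  `T`'s own ideles — at every tabulated datum (Frey / HEX rows are rational) the (P) and (U) licences of the M line are ONE predicate. (At the NUMBER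
  level the two readings already agree at `d_mod = 1`: abc-iut-c312-d1 `cor312Of_iff_perImage_of_finrank_eq_one`.)

HONEST SCOPE: statements about OUR typed objects at OUR M-level setting; the K line (carriers = all places of `K`, many per prime) is NOT covered — there
(P) is strictly stronger than (U) at mixed summands; nothing here bears on the printed GLOBAL inequality or takes a side on any author; decided-as-typed ≠
decided-in-print; typed ≠ proved (these: proved). [cite: Mochizuki2012, IUTchIII Cor. 3.12 p. 173–174, Step (x) p. 181, Step (xi-f) p. 184; Thm. 3.11 (i)
(Ind1)(Ind2) p. 154; IUTchI Def. 3.1 (e) p. 62; IUTchIV Thm. 1.10 p. 22] [cite: DupuyHilado2025, §3.4, §3.9, §4.9, §4.11–4.12] [claim: Mochizuki2012,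
status: disputed] for every IUT sentence quoted.
-/

noncomputable section

open Set Function NumberField IsDedekindDomain
open scoped Pointwise

namespace Summit.ABC.IUTFork.Thm311.Real

open Cor312 Cor312Vol Literature.IUT.LogThetaLattice Literature.IUT.LogVolume Literature.IUT.HodgeTheaters
  Literature.NumberTheory.NumberFields Literature.NumberTheory.GaloisRepresentations.Ultrametric

variable {F K Fbar : Type} [Field F] [NumberField F] [Field K] [NumberField K] [Algebra F K]
  [Field Fbar] [Algebra F Fbar] [Algebra K Fbar] {E : WeierstrassCurve F} [E.IsElliptic] {l : ℕ}
  {Pb : BadPlacePredicates K} (D : InitialThetaData F K Fbar E l Pb) {logvK : PadicLogsVal K}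
  (hlog : LogvAnalyticVal logvK)
  (t : ∀ (u : FinitePlace ℚ) (_ : Fin (thetaIndexOfInitial D).lstar) (x : (thetaIndexOfInitial D).Fibre (Val.non u)),
    kOfM D (ratChar u) u (natCast_ratChar_mem u) x)
  (tq : ∀ (u : FinitePlace ℚ) (x : (thetaIndexOfInitial D).Fibre (Val.non u)),
    kOfM D (ratChar u) u (natCast_ratChar_mem u) x)
  (M : Type) [Field M] [NumberField M]
  (archPk : ∀ (j : (thetaIndexOfInitial D).Label) (vQ : (thetaIndexOfInitial D).VQ),
    Set ((logShellsOfInitialDH D logvK).Packet j vQ))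
  (archSub : ∀ (j : (thetaIndexOfInitial D).Label) (v : (thetaIndexOfInitial D).V),
    Set ((logShellsOfInitialDH D logvK).Packet j ((thetaIndexOfInitial D).over v)))
  (Ψ : ℤ → ∀ v : (thetaIndexOfInitial D).V, v ∈ (thetaIndexOfInitial D).Vbad →
    Set ((logShellsOfInitialDH D logvK).StarPacket v))
  (act : ℤ → ∀ v : (thetaIndexOfInitial D).V, v ∈ (thetaIndexOfInitial D).Vbad →
    (logShellsOfInitialDH D logvK).StarPacket v → Module.End ℚ ((logShellsOfInitialDH D logvK).StarPacket v))
  (Mmod : ℤ → ∀ j : (thetaIndexOfInitial D).LabelStar, Set ((logShellsOfInitialDH D logvK).GlobalPacket j.1))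
  (region : ℤ → ∀ j : (thetaIndexOfInitial D).LabelStar, FinDivisor M → ∀ vQ : (thetaIndexOfInitial D).VQ,
    Set ((logShellsOfInitialDH D logvK).Packet j.1 vQ))
  (n : ℤ) {HT : Type} {LogLink : HT → HT → Type} {IsFull : ∀ {s t : HT}, LogLink s t → Prop}
  (lat : LGPGaussianLogThetaLattice LogLink IsFull)
  {Frd : Type} {IsoF : Frd → Frd → Type} {Ob : Frd → Type} {realify : Frd → Frd} {Strip : Type}
  {IsoS : Strip → Strip → Type}
  {Mv : ∀ v : (thetaIndexOfInitial D).V, v ∈ (thetaIndexOfInitial D).Vbad → Type} [∀ v h, Monoid (Mv v h)]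
  (sig : GlobalLGPFrobenioidSignature (thetaIndexOfInitial D).lstar (thetaIndexOfInitial D).V
    (· ∈ (thetaIndexOfInitial D).Vbad) Frd IsoF Ob realify Strip IsoS Mv)
  (split : SplittingMonoids Mv) {ObΔ : Type}
  {N : ∀ v : (thetaIndexOfInitial D).V, v ∈ (thetaIndexOfInitial D).Vbad → Type} [∀ v h, Monoid (N v h)]
  (qData : QPilotData ObΔ N)
  (htq0 : ∀ u x, tq u x ≠ 0) (Sq : Finset (FinitePlace ℚ))
  (htq1 : ∀ (u : FinitePlace ℚ) (x : (thetaIndexOfInitial D).Fibre (Val.non u)), u ∉ Sq → ‖tq u x‖ = 1)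

/-! ## §1. (P) = (U) at the licence level over subsingleton fibres -/

/-- **Per packet over a subsingleton fibre, `qRegion ⊆ slot hull ↔ qRegion ⊆ full hull`** (non-zero Θ-ideles): every summand `v⃗` is constant, so the
antecedents of the two radii-form deciders (this seat's p470778 for the slot hull — LAST slot; abc-iut-w5-d166's for the full hull — ALL slots) coincide;
the radii witnesses are chosen by abc-iut-w4-d026's `exists_shellRadii_witnesses` (any place, any ramification). [cite: Mochizuki2012, IUTchIII Cor. 3.12
Step (x) p. 181, Step (xi-f) p. 184] [cite: DupuyHilado2025, §4.9, §4.11–4.12] -/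
theorem qRegion_subset_thetaSlotHull_iff_thetaHull_settingPrVolSharpM_of_subsingleton (ht0 : ∀ u i x, t u i x ≠ 0)
    (j : (thetaIndexOfInitial D).Label) (u : FinitePlace ℚ)
    (hx : ∀ x y : (thetaIndexOfInitial D).Fibre (Val.non u), x = y) :
    (settingPrVolSharpM D hlog t tq M archPk archSub Ψ act Mmod region n lat sig split qData htq0 Sq htq1).qRegion j (Val.non u) ⊆
      (settingPrVolSharpM D hlog t tq M archPk archSub Ψ act Mmod region n lat sig split qData htq0 Sq htq1).thetaSlotHull j (Val.non u) ↔
    (settingPrVolSharpM D hlog t tq M archPk archSub Ψ act Mmod region n lat sig split qData htq0 Sq htq1).qRegion j (Val.non u) ⊆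
      (settingPrVolSharpM D hlog t tq M archPk archSub Ψ act Mmod region n lat sig split qData htq0 Sq htq1).thetaHull j (Val.non u) := by
  classical
  -- shell-radius witnesses at every member of every fibre
  have hw := fun (u' : FinitePlace ℚ) (x : (thetaIndexOfInitial D).Fibre (Val.non u')) =>
    exists_shellRadii_witnesses (ratChar u') (K := kOfM D (ratChar u') u' (natCast_ratChar_mem u') x)
  choose cin cout hin0 hin hmax _hout0 houtΛ hdom using hw
  rw [qRegion_subset_thetaSlotHull_settingPrVolSharpM_iff_radii D hlog t tq M archPk archSub Ψ act Mmod region n lat sig split qData htq0 Sq htq1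
      ht0 cin cout hin0 hin hmax houtΛ hdom j u,
    qRegion_subset_thetaHull_settingPrVolSharpM_iff_radii D hlog t tq M archPk archSub Ψ act Mmod region n lat sig split qData htq0 Sq htq1
      ht0 cin cout hin0 hin hmax houtΛ hdom j u]
  refine forall_congr' fun e => forall_congr' fun m => imp_congr ?_ Iff.rfl
  refine ⟨fun h a J => ?_, fun h J => h (Fin.last _) J⟩
  rw [hx (e a) (e (Fin.last _))]
  exact h J

/-- **`SlotLicence ↔ Licence` at the M-level setting when EVERY fibre `V̲_u` is a subsingleton** (non-zero Θ-ideles; archimedean packets automatic on both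
sides). Readings (P) and (U) of Step (xi-f) are ONE predicate there. [cite: Mochizuki2012, IUTchIII Cor. 3.12 Step (xi-f) p. 184; Thm. 3.11 (i) (Ind1) p. 154]
[cite: DupuyHilado2025, §4.11–4.12] -/
theorem slotLicence_iff_licence_settingPrVolSharpM_of_subsingleton (ht0 : ∀ u i x, t u i x ≠ 0)
    (hx : ∀ (u : FinitePlace ℚ) (x y : (thetaIndexOfInitial D).Fibre (Val.non u)), x = y) :
    (settingPrVolSharpM D hlog t tq M archPk archSub Ψ act Mmod region n lat sig split qData htq0 Sq htq1).SlotLicence ↔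
      Thm311ToCor312.Licence (settingPrVolSharpM D hlog t tq M archPk archSub Ψ act Mmod region n lat sig split qData htq0 Sq htq1) := by
  refine forall_congr' fun i => forall_congr' fun vQ => ?_
  rcases vQ with w | u
  · exact ⟨fun _ => qRegion_subset_thetaHull_settingPrVolSharpM_arc D hlog t tq M archPk archSub Ψ act Mmod region n lat sig split qData htq0 Sq
        htq1 _ w,
      fun _ => qRegion_subset_thetaSlotHull_settingPrVolSharpM_arc D hlog t tq M archPk archSub Ψ act Mmod region n lat sig split qData htq0 Sq
        htq1 _ w⟩
  · exact qRegion_subset_thetaSlotHull_iff_thetaHull_settingPrVolSharpM_of_subsingleton D hlog t tq M archPk archSub Ψ act Mmod region n lat sig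
      split qData htq0 Sq htq1 ht0 _ u (hx u)

/-- **Over subsingleton fibres the (U) licence IMPLIES the slot licence** — hence so does the q-pinned hull-level clause S_H of the M books
(`PilotKummerCompatHull … (fun _ => qRegion) qK ⟹ Licence`, abc-iut-w5-d068 `licence_of_pilotKummerCompatHull`, q-pin by `rfl`): **`¬ SlotLicence → ¬ Licence
→ ¬ S_H`** there — wherever the M-line γ binder `hNumPOffBad_M` (p469493) is consumed, the M-line (U) binder `hNumOffBad_M` (p451523 / p457739) is too.
[cite: Mochizuki2012, IUTchIII Cor. 3.12 Step (xi-d) p. 183, (xi-f) p. 184] [cite: DupuyHilado2025, §4.12] -/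
theorem slotLicence_of_licence_settingPrVolSharpM_of_subsingleton (ht0 : ∀ u i x, t u i x ≠ 0)
    (hx : ∀ (u : FinitePlace ℚ) (x y : (thetaIndexOfInitial D).Fibre (Val.non u)), x = y)
    (hlic : Thm311ToCor312.Licence (settingPrVolSharpM D hlog t tq M archPk archSub Ψ act Mmod region n lat sig split qData htq0 Sq htq1)) :
    (settingPrVolSharpM D hlog t tq M archPk archSub Ψ act Mmod region n lat sig split qData htq0 Sq htq1).SlotLicence :=
  (slotLicence_iff_licence_settingPrVolSharpM_of_subsingleton D hlog t tq M archPk archSub Ψ act Mmod region n lat sig split qData htq0 Sq htq1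
    ht0 hx).mpr hlic

/-- Contrapositive: over subsingleton fibres, **a failure of the SLOT licence is a failure of the (U) licence** (and of S_H). [folklore] -/
theorem not_licence_of_not_slotLicence_settingPrVolSharpM_of_subsingleton (ht0 : ∀ u i x, t u i x ≠ 0)
    (hx : ∀ (u : FinitePlace ℚ) (x y : (thetaIndexOfInitial D).Fibre (Val.non u)), x = y)
    (hns : ¬ (settingPrVolSharpM D hlog t tq M archPk archSub Ψ act Mmod region n lat sig split qData htq0 Sq htq1).SlotLicence) :
    ¬ Thm311ToCor312.Licence (settingPrVolSharpM D hlog t tq M archPk archSub Ψ act Mmod region n lat sig split qData htq0 Sq htq1) :=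
  fun hlic => hns (slotLicence_of_licence_settingPrVolSharpM_of_subsingleton D hlog t tq M archPk archSub Ψ act Mmod region n lat sig split qData
    htq0 Sq htq1 ht0 hx hlic)

end Summit.ABC.IUTFork.Thm311.Real

/-! ## §2. Genuine data over a point with `d_mod = 1`: every fibre of the M-level index skeleton is a subsingleton -/

namespace Summit.ABC.IUTFork.Conditional

open Thm311 Thm311.Real Cor312 Cor312Vol Literature.IUT.LogThetaLattice Literature.IUT.LogVolume Literature.IUT.HodgeTheaters
  Literature.IUT.LogVolume.ThetaData Literature.NumberTheory.NumberFields Literature.NumberTheory.DiophantineGeometry.GenEll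

/-- **The fibres `V̲_u` of a genuine Θ-volume datum over a point with `d_mod = 1` are subsingletons**: `V̲_u ≅ V(F_mod)_{p_u}` (abc-iut-w5-d033
`fibreEquivPlacesOverM`), `[F_mod : ℚ] = d_mod = 1` (abc-iut-S-d2 `finrank_rat_fieldOfModuli_eq_dmod`), and a degree-one field has one place over each prime
(abc-iut-c312-d1 `ValLine.placesOver_subsingleton_of_finrank_eq_one`). [cite: Mochizuki2012, IUTchI Def. 3.1 (e) p. 62; IUTchIV Thm. 1.10 p. 22] -/
theorem GenuineMSlot.fibre_subsingleton_of_dmod_eq_one {P : NFPoint} {l : ℕ} (T : Cor22.ThetaVolumeDatumAt P l) (hd : Cor22.dmod P = 1)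
    (u : FinitePlace ℚ) :
    letI := T.instFieldF; letI := T.instNumberFieldF; letI := T.instAlgebraF; letI := T.instFieldK;
    letI := T.instNumberFieldK; letI := T.instAlgebraK; letI := T.instFieldFbar; letI := T.instAlgebraFbar;
    letI := T.instAlgebraKFbar; letI := T.instIsElliptic;
    ∀ x y : (thetaIndexOfInitial T.D).Fibre (Val.non u), x = y := by
  letI := T.instFieldF; letI := T.instNumberFieldF; letI := T.instAlgebraF; letI := T.instFieldK
  letI := T.instNumberFieldK; letI := T.instAlgebraK; letI := T.instFieldFbar; letI := T.instAlgebraFbar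
  letI := T.instAlgebraKFbar; letI := T.instIsElliptic
  intro x y
  have hF : Module.finrank ℚ (fieldOfModuli T.E) = 1 := T.finrank_rat_fieldOfModuli_eq_dmod.trans hd
  apply (fibreEquivPlacesOverM T.D (ratChar u) u (natCast_ratChar_mem u)).injective
  exact ValLine.placesOver_subsingleton_of_finrank_eq_one hF (ratChar u) _ _

/-- **READINGS (P) AND (U) OF STEP (xi-f) ARE ONE PREDICATE ON THE M LINE AT EVERY GENUINE DATUM OVER A POINT WITH `d_mod = 1`** (every rational point —
all tabulated Frey / HEX data): at the M books' setting of `T`'s own ideles (abc-iut-s2-p8 `settingPrVolSharpM`, Θ-ideles `tOfIdeleData T.D (ideleDataOf …)`,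
ANY non-zero q-ideles `tq` units off `Sq`, any context binders), `SlotLicence ↔ Thm311ToCor312.Licence`. CONSEQUENCE FOR THE BOOKS: at such data the
antecedent «OUR M-level SLOT licence fails» of `hNumPOffBad_M` / `hNumPOffC_M` (p469493) and the licence-level antecedent of the (U) line are the same
condition; by abc-iut-c312-d1's `cor312Of_iff_perImage_of_finrank_eq_one` the CONCLUSIONS `T.Cor312PerImageOf` / `T.Cor312Of` agree there too.
(The K line is NOT covered: its carriers are all places of `K` over `p`.) [cite: Mochizuki2012, IUTchIII Cor. 3.12 Step (xi-f) p. 184; IUTchIV Thm. 1.10 p. 22]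
[cite: DupuyHilado2025, §4.11–4.12] [claim: Mochizuki2012, status: disputed] -/
theorem GenuineMSlot.slotLicence_iff_licence_of_dmod_eq_one {P : NFPoint} {l : ℕ} (T : Cor22.ThetaVolumeDatumAt P l) (hd : Cor22.dmod P = 1)
    (M : Type) [Field M] [NumberField M]
    (archPk : letI := T.instFieldF; letI := T.instNumberFieldF; letI := T.instAlgebraF; letI := T.instFieldK;
        letI := T.instNumberFieldK; letI := T.instAlgebraK; letI := T.instFieldFbar; letI := T.instAlgebraFbar;
        letI := T.instAlgebraKFbar; letI := T.instIsElliptic;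
      ∀ (j : (thetaIndexOfInitial T.D).Label) (vQ : (thetaIndexOfInitial T.D).VQ), Set ((logShellsOfInitialDH T.D (analyticLogvVal T.K)).Packet j vQ))
    (archSub : letI := T.instFieldF; letI := T.instNumberFieldF; letI := T.instAlgebraF; letI := T.instFieldK;
        letI := T.instNumberFieldK; letI := T.instAlgebraK; letI := T.instFieldFbar; letI := T.instAlgebraFbar;
        letI := T.instAlgebraKFbar; letI := T.instIsElliptic;
      ∀ (j : (thetaIndexOfInitial T.D).Label) (v : (thetaIndexOfInitial T.D).V), Set ((logShellsOfInitialDH T.D (analyticLogvVal T.K)).Packet j ((thetaIndexOfInitial T.D).over v)))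
    (Ψ : letI := T.instFieldF; letI := T.instNumberFieldF; letI := T.instAlgebraF; letI := T.instFieldK;
        letI := T.instNumberFieldK; letI := T.instAlgebraK; letI := T.instFieldFbar; letI := T.instAlgebraFbar;
        letI := T.instAlgebraKFbar; letI := T.instIsElliptic;
      ℤ → ∀ v : (thetaIndexOfInitial T.D).V, v ∈ (thetaIndexOfInitial T.D).Vbad → Set ((logShellsOfInitialDH T.D (analyticLogvVal T.K)).StarPacket v))
    (act : letI := T.instFieldF; letI := T.instNumberFieldF; letI := T.instAlgebraF; letI := T.instFieldK;
        letI := T.instNumberFieldK; letI := T.instAlgebraK; letI := T.instFieldFbar; letI := T.instAlgebraFbar;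
        letI := T.instAlgebraKFbar; letI := T.instIsElliptic;
      ℤ → ∀ v : (thetaIndexOfInitial T.D).V, v ∈ (thetaIndexOfInitial T.D).Vbad → (logShellsOfInitialDH T.D (analyticLogvVal T.K)).StarPacket v → Module.End ℚ ((logShellsOfInitialDH T.D (analyticLogvVal T.K)).StarPacket v))
    (Mmod : letI := T.instFieldF; letI := T.instNumberFieldF; letI := T.instAlgebraF; letI := T.instFieldK;
        letI := T.instNumberFieldK; letI := T.instAlgebraK; letI := T.instFieldFbar; letI := T.instAlgebraFbar;
        letI := T.instAlgebraKFbar; letI := T.instIsElliptic;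
      ℤ → ∀ j : (thetaIndexOfInitial T.D).LabelStar, Set ((logShellsOfInitialDH T.D (analyticLogvVal T.K)).GlobalPacket j.1))
    (region : letI := T.instFieldF; letI := T.instNumberFieldF; letI := T.instAlgebraF; letI := T.instFieldK;
        letI := T.instNumberFieldK; letI := T.instAlgebraK; letI := T.instFieldFbar; letI := T.instAlgebraFbar;
        letI := T.instAlgebraKFbar; letI := T.instIsElliptic;
      ℤ → ∀ j : (thetaIndexOfInitial T.D).LabelStar, FinDivisor M → ∀ vQ : (thetaIndexOfInitial T.D).VQ, Set ((logShellsOfInitialDH T.D (analyticLogvVal T.K)).Packet j.1 vQ))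
    (n : ℤ) {HT : Type} {LogLink : HT → HT → Type} {IsFull : ∀ {s t : HT}, LogLink s t → Prop}
    (lat : LGPGaussianLogThetaLattice LogLink IsFull)
    {Frd : Type} {IsoF : Frd → Frd → Type} {Ob : Frd → Type} {realify : Frd → Frd} {Strip : Type} {IsoS : Strip → Strip → Type}
    {Mv : letI := T.instFieldF; letI := T.instNumberFieldF; letI := T.instAlgebraF; letI := T.instFieldK;
        letI := T.instNumberFieldK; letI := T.instAlgebraK; letI := T.instFieldFbar; letI := T.instAlgebraFbar;
        letI := T.instAlgebraKFbar; letI := T.instIsElliptic;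
      ∀ v : (thetaIndexOfInitial T.D).V, v ∈ (thetaIndexOfInitial T.D).Vbad → Type}
    [∀ v h, Monoid (Mv v h)]
    (sig : letI := T.instFieldF; letI := T.instNumberFieldF; letI := T.instAlgebraF; letI := T.instFieldK;
        letI := T.instNumberFieldK; letI := T.instAlgebraK; letI := T.instFieldFbar; letI := T.instAlgebraFbar;
        letI := T.instAlgebraKFbar; letI := T.instIsElliptic;
      GlobalLGPFrobenioidSignature (thetaIndexOfInitial T.D).lstar (thetaIndexOfInitial T.D).V (· ∈ (thetaIndexOfInitial T.D).Vbad) Frd IsoF Ob realify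
        Strip IsoS Mv)
    (split : SplittingMonoids Mv) {ObΔ : Type}
    {N : letI := T.instFieldF; letI := T.instNumberFieldF; letI := T.instAlgebraF; letI := T.instFieldK;
        letI := T.instNumberFieldK; letI := T.instAlgebraK; letI := T.instFieldFbar; letI := T.instAlgebraFbar;
        letI := T.instAlgebraKFbar; letI := T.instIsElliptic;
      ∀ v : (thetaIndexOfInitial T.D).V, v ∈ (thetaIndexOfInitial T.D).Vbad → Type}
    [∀ v h, Monoid (N v h)] (qData : QPilotData ObΔ N)
    (tq : letI := T.instFieldF; letI := T.instNumberFieldF; letI := T.instAlgebraF; letI := T.instFieldK;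
        letI := T.instNumberFieldK; letI := T.instAlgebraK; letI := T.instFieldFbar; letI := T.instAlgebraFbar;
        letI := T.instAlgebraKFbar; letI := T.instIsElliptic;
      ∀ (u : FinitePlace ℚ) (x : (thetaIndexOfInitial T.D).Fibre (Val.non u)), kOfM T.D (ratChar u) u (natCast_ratChar_mem u) x)
    (htq0 : ∀ u x, tq u x ≠ 0) (Sq : Finset (FinitePlace ℚ))
    (htq1 : ∀ (u : FinitePlace ℚ) (x : letI := T.instFieldF; letI := T.instNumberFieldF; letI := T.instAlgebraF; letI := T.instFieldK;
        letI := T.instNumberFieldK; letI := T.instAlgebraK; letI := T.instFieldFbar; letI := T.instAlgebraFbar;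
        letI := T.instAlgebraKFbar; letI := T.instIsElliptic; (thetaIndexOfInitial T.D).Fibre (Val.non u)), u ∉ Sq → ‖tq u x‖ = 1) :
    letI := T.instFieldF; letI := T.instNumberFieldF; letI := T.instAlgebraF; letI := T.instFieldK;
    letI := T.instNumberFieldK; letI := T.instAlgebraK; letI := T.instFieldFbar; letI := T.instAlgebraFbar;
    letI := T.instAlgebraKFbar; letI := T.instIsElliptic;
    (settingPrVolSharpM T.D (logvAnalyticVal_analyticLogvVal (K := T.K)) (tOfIdeleData T.D (ideleDataOf T.D T.isVolumeInputOf)) tq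
        M archPk archSub Ψ act Mmod region n lat sig split qData htq0 Sq htq1).SlotLicence ↔
      Thm311ToCor312.Licence
        (settingPrVolSharpM T.D (logvAnalyticVal_analyticLogvVal (K := T.K)) (tOfIdeleData T.D (ideleDataOf T.D T.isVolumeInputOf)) tq
          M archPk archSub Ψ act Mmod region n lat sig split qData htq0 Sq htq1) := by
  letI := T.instFieldF; letI := T.instNumberFieldF; letI := T.instAlgebraF; letI := T.instFieldK
  letI := T.instNumberFieldK; letI := T.instAlgebraK; letI := T.instFieldFbar; letI := T.instAlgebraFbar
  letI := T.instAlgebraKFbar; letI := T.instIsElliptic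
  exact slotLicence_iff_licence_settingPrVolSharpM_of_subsingleton T.D (logvAnalyticVal_analyticLogvVal (K := T.K))
    (tOfIdeleData T.D (ideleDataOf T.D T.isVolumeInputOf)) tq M archPk archSub Ψ act Mmod region n lat sig split qData htq0 Sq htq1
    (tOfIdeleData_ne_zero T.D _) (GenuineMSlot.fibre_subsingleton_of_dmod_eq_one T hd)

end Summit.ABC.IUTFork.Conditional

end
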